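import Literature.NumberTheory.Rogawski1990.FinExplicitTransferFactorLeviStratum

/-!
# R90 · S6 (Rogawski Ch. 14.1–5, stable trace formula) — W7-d: the explicit transfer factor `Δ‴_v` on the DIAGONAL (split) torus
# at an unramified inert place: `Δ‴_v(γ_H, γ₀) = (−q)^{−(n₁₂ + n₂₃)}`, no `κ`-sign

Helper for the S6 floor (E1-c) `R90.S6.StubR90ExtE1HeckeFL` (`Cruxes/H413/Lines/R90_S6_FloorE1D.lean`), closure DAG row E1.3.6.1
«transfer-factor and discriminant values on the DIAGONAL tori at an unramified inert `w`», card W7-d of the S6 WAVE 7 menu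
(`R90/R90-szE1.1/g3/CLOSURE-E1.1.md` §3); consumed by E1.3.6.2 (the constant-term identity = hyperbolic half of Prop. 4.9.1 (b)).

THE MATHEMATICS [Rogawski1990 §4.9 p. 55]: `Δ_{G∕H}(γ) = τ(γ) D_{G∕H}(γ)` with `τ(γ) = μ(γ₂)μ⁻¹((γ₂γ₁⁻¹ − 1)(1 − γ₂γ₃⁻¹))`,
`D_{G∕H}(γ) = |Π_{α∉H}(1 − α(γ))|_F^{1∕2}`; at a `p`-adic place with `E∕F` and `μ` unramified and `μ|_{F^×} = ω_{E∕F}` (so `μ(ϖ) = −1`):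
`τ(γ) = (−1)^{n₁₂+n₂₃}`, `D_{G∕H}(γ) = q^{−(n₁₂+n₂₃)}`, `n_{ij} = ord_E(γᵢ − γⱼ)`.  On the DIAGONAL torus `γ = ι(γ_H) = diag(d₀, d₁, d₂)` of
`U(Φ₃)` (`d₂ = σ(d₀)⁻¹`, `σ(d₁)d₁ = 1`; `γ_H = (diag(d₀, d₂), d₁)`), REGULAR (`dᵢ ≠ dⱼ`), the stable class of `γ` is ONE conjugacy class
(`𝔇(T∕F) = ker(H¹(F, T) → H¹(F, G)) = 1` for the maximally split torus, §3.6 pp. 28–29) and the endoscopic sign is `κ = +1` on it, so the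
tree's two-variable factor ★ `finExplicitDelta L v H′ γ_H μ γ₀ = τ_v · D_v · κ_v` takes, at EVERY `γ₀ ∈ U(H′)(L⁺_v)` matching `γ_H`, the value
  `Δ‴_v(γ_H, γ₀) = (−q)^{m}`, `m = log v_w(((d₁ − d₀)(d₁ − d₂))_w) = −ord_w χ_g(u) = −(n₁₂ + n₂₃)`, `q = #k_v`
(`χ_g(u) = (d₁ − d₀)(d₁ − d₂)` is the `U(Φ₂)`-characteristic polynomial of `g = diag(d₀, d₂)` at `u = d₁`; Mathlib's `Valued.v ϖ_w = exp(−1)`).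
No integrality of `γ` is assumed (the Hecke-level stratum `ord_w d₀ ≠ 0` is included; there `m = |ord_w d₀|`, sequel file
`R90S6TransferFactorDiagHecke`); on `T(𝒪_v)` this specialises to ★ `finExplicitDelta_eq_unitModulusChar_of_levi_of_nonsplit` (`= ‖d₀⁻¹d₁ − 1‖`).

PROOF = two ★ organs of the unit estate: ★ `finExplicitDelta_eq_neg_absNorm_zpow_mul_kappa_of_nonsplit_of_isUnramifiedIn` (`Δ‴_v = (−q)^m · κ_v` on any
`(G,H)`-regular matching pair at an unramified inert place, [`FinExplicitTransferFactorInertPlaceValuation`]) and ★ `finKappaAt_eq_one_of_levi_of_nonsplit`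
(`κ_v = 1` on the regular diagonal stratum, no integrality, [`FinExplicitTransferFactorLeviStratum` §3]), with `χ_g(u)` read off the frame by ★
`eval_finCharpolyTwo_eq_of_endoEmbLocal_eq`.

Cell `hodgecm-mathlib`, crux H413 (`stmt-HodgeConjecture-24833`), route of record `HCCMUnconditional`; programme R90-TF (brief
`director/R90-BRIEF.v2.md`), section S6 (base `R90-C14`), seat R90-C14-p02 (g2), card W7-d (S6 dealer R90-C14-plan (g2) 2026-09-04T23:24:27Z).
Lane `--supports stmt-HodgeConjecture-24833 --as helper`; ONE public theorem, no definition, no `sorry`, no instance, no notation.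
INHABITED-AT-RAMIFIED: N∕A — inert (`c • w = w`) unramified `v` only.  HONEST LABEL: a helper theorem, count-neutral until the E1.3.6.2 ∕ E1.3.9
assembly consumes it; HC_CM is proved only modulo the 7 printed citations (2 remaining named inputs: hLiu418 = stmt-HodgeConjecture-24832,
h413 = stmt-HodgeConjecture-24833) until rung 0 closes.

## References
* [Rogawski1990] J. D. Rogawski, *Automorphic Representations of Unitary Groups in Three Variables*, Ann. of Math. Stud. 123 (1990):
  §4.9 p. 55 (`τ`, `D_{G∕H}`, `Δ_{G∕H} = τ D_{G∕H}`, Prop. 4.9.1 (b)); §3.6 pp. 28–29 (`𝔇(T∕F) = 1` for the split torus); §4.3 p. 43; §14.6 p. 242.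
* [LanglandsShelstad1987] R. P. Langlands, D. Shelstad, *On the definition of transfer factors*, Math. Ann. 278 (1987), §3 (`Δ_IV`).
-/

set_option autoImplicit false
-- the mandated namespace repeats the single-problem summit's segment (`HodgeConjecture.HodgeConjecture`)
set_option linter.dupNamespace false

noncomputable section

open NumberField IsDedekindDomain Matrix Polynomial
open scoped MatrixGroups NNReal
open Literature.NumberTheory.Automorphic Literature.NumberTheory.Automorphic.UnitaryGroup
open Literature.NumberTheory.GaloisRepresentations
open Literature.NumberTheory.Rogawski1990

namespace Summit.HodgeConjecture.HodgeConjecture.R90.S6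

/-- **ROGAWSKI'S EXPLICIT TRANSFER FACTOR ON THE DIAGONAL TORUS AT AN UNRAMIFIED INERT PLACE: `Δ‴_v(γ_H, γ₀) = (−q)^{−(n₁₂+n₂₃)}`, NO `κ`-SIGN.**
At a finite place `v` of `L⁺` non-split (`c • w = w`) and unramified in the CM field `L`, for `H′` hermitian with `det H′ ≠ 0` of good reduction
at `w` (`placeForm H′ w ∈ GL₃(𝒪_w)`), `μ` unramified at `w` under the μ-guard `μ|_{𝕀_{L⁺}} = ω_{L∕L⁺}`, and `γ_H ∈ H_v` with
`ι_v(γ_H) = diag(d₀, d₁, d₂)` REGULAR (`dᵢ − dⱼ` units of `∏_{w∣v} L_w`; no integrality): at EVERY `γ₀ ∈ U(H′)(L⁺_v)` matching `γ_H`,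
`finExplicitDelta L v H′ γ_H μ γ₀ = (−#k_v)^{log v_w(((d₁ − d₀)(d₁ − d₂))_w)}` — print's `Δ_{G∕H}(γ) = τ(γ) D_{G∕H}(γ) = (−1)^{n₁₂+n₂₃} q^{−(n₁₂+n₂₃)}`
(`n_{ij} = ord_w(γᵢ − γⱼ)`, `γ₂ = u = d₁`), the endoscopic sign being `+1` on the single conjugacy class that is the stable class of a
split-torus element. [cite: Rogawski1990, §4.9 p. 55, Prop. 4.9.1 (b); §3.6 pp. 28–29; §4.3 p. 43; §14.6 p. 242] [cite: LanglandsShelstad1987, §3] -/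
theorem transferFactor_diag_value (L : Type) [Field L] [NumberField L] [IsCMField L]
    (H' : Matrix (Fin 3) (Fin 3) L) (hH' : (H'.map (IsCMField.complexConj L))ᵀ = H') (hH'd : IsUnit H'.det)
    {v : HeightOneSpectrum (𝓞 ↥(maximalRealSubfield L))} (w : PlacesOver L v) (hw : IsCMField.complexConj L • w.1 = w.1)
    (hv : Algebra.IsUnramifiedIn (𝓞 L) v.asIdeal) (hH'w : IsUnit (placeForm H' w.1)) (hH'i : hH'w.unit ∈ glInt 3 (w.1.adicCompletion L))
    (μ : HeckeCharacter L) (hμ : μ.IsUnramifiedAt w.1)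
    (hμω : ∀ x : ideleGroup ↥(maximalRealSubfield L), μ (AdeleRing.ideleBaseChange ↥(maximalRealSubfield L) L x) = quadraticHeckeCharCM L x)
    (γH : (cmDatum L 2 (Matrix.of fun i j : Fin 2 => if i.val + j.val + 1 = 2 then (1 : L) else 0)).Local v ×
      (cmDatum L 1 (Matrix.of fun i j : Fin 1 => if i.val + j.val + 1 = 1 then (1 : L) else 0)).Local v)
    {d : Fin 3 → (UnitaryGroup.LocalRing L v)ˣ}
    (hι : ((endoEmbLocal L v γH).val : GL (Fin 3) (UnitaryGroup.LocalRing L v)) = glDiagonal 3 (UnitaryGroup.LocalRing L v) d)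
    (hreg : ∀ i j, i ≠ j → IsUnit ((d i : UnitaryGroup.LocalRing L v) - d j))
    {γ₀ : (cmDatum L 3 H').Local v} (h₀ : IsLocalNormPair L H' v γH γ₀) :
    finExplicitDelta L v H' γH μ γ₀ =
      (-(Ideal.absNorm v.asIdeal : ℂ)) ^
        WithZero.log (Valued.v ((((d 1 : UnitaryGroup.LocalRing L v) - d 0) * ((d 1 : UnitaryGroup.LocalRing L v) - d 2)) w)) := by
  classical
  -- `χ_g(u) = (d₁ − d₀)(d₁ − d₂)` is a unit by regularity
  have hχ : (finCharpolyTwo L v γH).eval (finGammaTwo L v γH) =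
      ((d 1 : UnitaryGroup.LocalRing L v) - d 0) * ((d 1 : UnitaryGroup.LocalRing L v) - d 2) :=
    eval_finCharpolyTwo_eq_of_endoEmbLocal_eq L v γH hι
  have hu : IsUnit ((finCharpolyTwo L v γH).eval (finGammaTwo L v γH)) := by
    rw [hχ]
    exact (hreg 1 0 (by decide)).mul (hreg 1 2 (by decide))
  rw [finExplicitDelta_eq_neg_absNorm_zpow_mul_kappa_of_nonsplit_of_isUnramifiedIn L v H' γH γ₀ w hw μ hμω hv hμ h₀ hu,
    finKappaAt_eq_one_of_levi_of_nonsplit L H' hH' hH'd w hw hv hH'w hH'i γH hι hreg h₀, hχ, Int.cast_one, mul_one]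

end Summit.HodgeConjecture.HodgeConjecture.R90.S6

end
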